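import Summits.AtomisticToContinuum.Crystallization.Theorems.ChargedEnergyGapChartDialP

/-!
# `ChargedEnergyGap` · the CHART DIAL, part Q: THE BOND-GRAPH SPLIT OF THE FINITE SHAPE STATEMENT
(decomp-a2c lens-3 g39 node «ChargeFreeGap», split beneath the feeder of hypothesis 3)

Part P made `TwelveShellShaped θ` the positions-only census statement over scale-free dozens `(t, b)` ((R1)–(R5),
here bundled as `IsScaleFreeDozen t b`).  This part splits that statement along the BOND GRAPH `b`:

* **[G] `DozenBondGraphs pf ph`** — the bond graph of every scale-free dozen is, up to a relabelling
  `σ : Equiv.Perm (Fin 12)`, the unit-distance graph of the cuboctahedral tuple `pf`, that of the anticuboctahedral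
  tuple `ph`, or the labelled hexagonal antiprism `apList` (COMBINATORIAL + FAN GEOMETRY).  The tree already PROVES
  the combinatorial engine for this — `Literature/Geometry/DiscreteGeometry/ShellCensusSearchFinal.lean`,
  `ShellCensusSearch.CF.concl` (verified 16-part growth search): every abstract census frame (closed fan surface on
  twelve labels, symmetric irreflexive 4-regular bond graph whose edges are sides and whose 3-cliques are triangles,
  no dead star `4T` / `3T+Q` / `3T+2H`) has the `patAdj 0 / 1 / 2` bond graph up to relabelling, with the dictionary
  `patAdj0_iff` / `patAdj1_iff` (squared integer bond `2` / `18` of `fccVec` / `hcpVec`) and `patAdj2_iff` (the SAME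
  edge list as `apList` below).  So [G] ⟸ FAN FRAMING of scale-free dozens (the radial projection of the bond graph
  is a planar map with empty bond triangles, refined to a triangulation; the dead stars cannot close up at `1 %`: a
  bonded triangle occupies an azimuth `≈ 70·5° ± 0·3°` around a vertex because (R2), (R4) pin the bond/radius ratio
  to `[0·99, 1·01]`, a bond quadrilateral between `≈ 70·5°` and `≈ 141°` because both diagonals are non-bonds (R5),
  so `4T ≈ 282°` and `3T+Q` (quadrilateral `≥ 147°`) do not reach `360°`) + `CF.concl` + that dictionary, in a file
  importing `ShellCensusSearchFinal` (not imported here: it rests on `Lean.ofReduceBool`, and this chain stays on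
  the standard axioms and on light imports).
* **[A] `NoAntiprismDozen`** — no scale-free dozen has the antiprism bond graph (a hexagon of sides `≤ 1·0201`
  whose vertices are at distance `∈ [1, 1·01]` from the centre is nearly flat and equatorial; two of them do not fit).
* **[C] `GraphedDozenClose θ p`** — METRIC NEAR-RIGIDITY: a scale-free dozen whose bond graph is the unit-distance
  graph of the pattern tuple `p` is `θ`-tuple-close to `p` (for the cuboctahedral graph the jitterbug flex reaches
  `≈ 0·1004 < 3/20` at the `1 %` stretch limit — census I-CHART(b); the anticuboctahedral graph flexes `≈ 0·03`).
* **`twelveShellShaped_of_bondGraphs`**: `DozenBondGraphs pf ph → NoAntiprismDozen → GraphedDozenClose θ pf →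
  GraphedDozenClose θ ph → TwelveShellShaped θ`, and the line `chartedChargePricing_of_far_cleanApproachHarnack_graphs`
  (`θ ≤ 3/20`).

No `sorry`, no new axiom, no instance / notation / option.  New definitions: `IsScaleFreeDozen`, `TupleIso`, `apList`,
`AntiprismIso`, `DozenBondGraphs`, `NoAntiprismDozen`, `GraphedDozenClose` (all `Prop`-valued but the list `apList`).
-/

noncomputable section

open Literature.MathematicalPhysics.StatisticalMechanics
open Literature.Geometry.DiscreteGeometry
open Literature.Geometry.DiscreteGeometry.ShellCensus
open Summit.AtomisticToContinuum.Crystallization.Theses.PricedLinkCensus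
open Summit.AtomisticToContinuum.Crystallization.Theorems.ChargedEnergyGapNegative

namespace Summit.AtomisticToContinuum.Crystallization.Theorems.ChargedEnergyGapChartDial

/-! ## §1 Scale-free dozens as one predicate -/

/-- **Scale-free dozen**: twelve positions `t` and a bond relation `b` satisfying (R1)–(R5) of part P (radii,
separation, `b` symmetric irreflexive with four bonds per vertex, bonds short at both ends, non-bonds long at one
end).  By part P this is EXACTLY the frame reading of a local dozen with its frame-bond relation. -/
def IsScaleFreeDozen (t : Fin 12 → E3) (b : Fin 12 → Fin 12 → Prop) : Prop :=
  (∀ i, 1 ≤ ‖t i‖ ∧ ‖t i‖ ≤ 101 / 100) ∧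
  (∀ i j, i ≠ j → ‖t i‖ ≤ 101 / 100 * dist (t i) (t j)) ∧
  (∀ i j, b i j → b j i) ∧ (∀ i, ¬ b i i) ∧ (∀ i, {j : Fin 12 | b i j}.ncard = 4) ∧
  (∀ i j, b i j → dist (t i) (t j) ≤ 101 / 100 * ‖t i‖ ∧
    ∀ k, k ≠ i → dist (t i) (t j) ≤ 101 / 100 * dist (t i) (t k)) ∧
  (∀ i j, i ≠ j → ¬ b i j →
    (‖t i‖ < dist (t i) (t j) ∧ ∀ k, b i k → dist (t i) (t k) < dist (t i) (t j)) ∨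
    (‖t j‖ < dist (t i) (t j) ∧ ∀ k, b j k → dist (t j) (t k) < dist (t i) (t j)))

/-- The frame-bond relation of a local dozen makes it a scale-free dozen. -/
theorem IsLocalDozen.isScaleFreeDozen {t : Fin 12 → E3} {ρ : Fin 12 → ℝ} (h : IsLocalDozen t ρ) :
    IsScaleFreeDozen t fun i j =>
      j ≠ i ∧ dist (t i) (t j) ≤ (1 + 1 / 100) * ρ i ∧ dist (t i) (t j) ≤ (1 + 1 / 100) * ρ j :=
  h.scaleFree

/-- A scale-free dozen comes from a local dozen with that frame-bond relation. -/
theorem IsScaleFreeDozen.exists_isLocalDozen {t : Fin 12 → E3} {b : Fin 12 → Fin 12 → Prop}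
    (h : IsScaleFreeDozen t b) : ∃ ρ : Fin 12 → ℝ, IsLocalDozen t ρ ∧
      ∀ i j, b i j ↔ (j ≠ i ∧ dist (t i) (t j) ≤ (1 + 1 / 100) * ρ i ∧ dist (t i) (t j) ≤ (1 + 1 / 100) * ρ j) :=
  exists_isLocalDozen_of_scaleFree t b h.1 h.2.1 h.2.2.1 h.2.2.2.1 h.2.2.2.2.1 h.2.2.2.2.2.1 h.2.2.2.2.2.2

/-- **`TwelveShellShaped` over scale-free dozens.** -/
theorem twelveShellShaped_iff_isScaleFreeDozen {θ : ℝ} {pf ph : Fin 12 → E3}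
    (hpf : Finset.univ.image pf = fccKissingPattern) (hph : Finset.univ.image ph = hcpKissingPattern) :
    TwelveShellShaped θ ↔
      ∀ (t : Fin 12 → E3) (b : Fin 12 → Fin 12 → Prop),
        IsScaleFreeDozen t b → TupleClose θ t pf ∨ TupleClose θ t ph := by
  rw [twelveShellShaped_iff_scaleFree hpf hph]
  exact ⟨fun h t b hD => h t b hD.1 hD.2.1 hD.2.2.1 hD.2.2.2.1 hD.2.2.2.2.1 hD.2.2.2.2.2.1 hD.2.2.2.2.2.2,
    fun h t b h1 h2 h3 h4 h5 h6 h7 => h t b ⟨h1, h2, h3, h4, h5, h6, h7⟩⟩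

/-! ## §2 Bond-graph types -/

/-- The relabelling `σ` carries the UNIT-DISTANCE GRAPH of the tuple `p` onto the bond relation `b` (for a tuple
enumerating a kissing pattern: the cuboctahedral / anticuboctahedral contact graph). -/
def TupleIso (b : Fin 12 → Fin 12 → Prop) (σ : Equiv.Perm (Fin 12)) (p : Fin 12 → E3) : Prop :=
  ∀ v w : Fin 12, v ≠ w → (b (σ v) (σ w) ↔ dist (p v) (p w) = 1)

/-- The labelled hexagonal antiprism: two hexagons `0–5`, `6–11` and the zigzag (verbatim the edge list
`ShellCensusSearch.apPairs` of the tree's frame census, cf. `patAdj2_iff`). -/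
def apList : List (ℕ × ℕ) :=
  [(0, 1), (1, 2), (2, 3), (3, 4), (4, 5), (0, 5), (6, 7), (7, 8), (8, 9), (9, 10), (10, 11), (6, 11), (0, 6), (1, 7),
   (2, 8), (3, 9), (4, 10), (5, 11), (1, 6), (2, 7), (3, 8), (4, 9), (5, 10), (0, 11)]

/-- The relabelling `σ` carries the labelled hexagonal antiprism onto the bond relation `b`. -/
def AntiprismIso (b : Fin 12 → Fin 12 → Prop) (σ : Equiv.Perm (Fin 12)) : Prop :=
  ∀ v w : Fin 12, v ≠ w → (b (σ v) (σ w) ↔ (min v.val w.val, max v.val w.val) ∈ apList)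

/-! ## §3 The three pieces -/

/-- **[G] Bond-graph trichotomy**: the bond graph of every scale-free dozen is, up to a relabelling, the
unit-distance graph of `pf`, that of `ph`, or the labelled antiprism.  (⟸ fan framing of scale-free dozens into
`ShellCensusSearch.CF` + the tree's `CF.concl` + the `patAdj` dictionary.) -/
def DozenBondGraphs (pf ph : Fin 12 → E3) : Prop :=
  ∀ (t : Fin 12 → E3) (b : Fin 12 → Fin 12 → Prop), IsScaleFreeDozen t b →
    ∃ σ : Equiv.Perm (Fin 12), TupleIso b σ pf ∨ TupleIso b σ ph ∨ AntiprismIso b σ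

/-- **[A] No antiprism**: no scale-free dozen has the hexagonal-antiprism bond graph. -/
def NoAntiprismDozen : Prop :=
  ∀ (t : Fin 12 → E3) (b : Fin 12 → Fin 12 → Prop), IsScaleFreeDozen t b →
    ∀ σ : Equiv.Perm (Fin 12), ¬ AntiprismIso b σ

/-- **[C] Graphed closeness** (metric near-rigidity): a scale-free dozen whose bond graph is the unit-distance
graph of the tuple `p` is `θ`-tuple-close to `p`. -/
def GraphedDozenClose (θ : ℝ) (p : Fin 12 → E3) : Prop :=
  ∀ (t : Fin 12 → E3) (b : Fin 12 → Fin 12 → Prop), IsScaleFreeDozen t b →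
    ∀ σ : Equiv.Perm (Fin 12), TupleIso b σ p → TupleClose θ t p

/-! ## §4 The split -/

/-- **The bond-graph split of the finite shape statement**: [G], [A] and [C] for both pattern tuples give
`TwelveShellShaped θ`. -/
theorem twelveShellShaped_of_bondGraphs {θ : ℝ} {pf ph : Fin 12 → E3}
    (hpf : Finset.univ.image pf = fccKissingPattern) (hph : Finset.univ.image ph = hcpKissingPattern)
    (hG : DozenBondGraphs pf ph) (hA : NoAntiprismDozen) (h0 : GraphedDozenClose θ pf)
    (h1 : GraphedDozenClose θ ph) : TwelveShellShaped θ := by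
  rw [twelveShellShaped_iff_isScaleFreeDozen hpf hph]
  intro t b hD
  obtain ⟨σ, hσ | hσ | hσ⟩ := hG t b hD
  · exact Or.inl (h0 t b hD σ hσ)
  · exact Or.inr (h1 t b hD σ hσ)
  · exact absurd hσ (hA t b hD σ)

/-- **The line of record through the bond-graph split** (`θ ≤ 3/20`). -/
theorem chartedChargePricing_of_far_cleanApproachHarnack_graphs {θ R M₀ M₁ : ℝ} (hθ : θ ≤ 3 / 20) (hR : 0 < R)
    (hM₀ : 0 ≤ M₀) (hFP : FarFieldPricing θ R) (hH : CleanApproachHarnack θ R M₀ M₁) {pf ph : Fin 12 → E3}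
    (hpf : Finset.univ.image pf = fccKissingPattern) (hph : Finset.univ.image ph = hcpKissingPattern)
    (hG : DozenBondGraphs pf ph) (hA : NoAntiprismDozen) (h0 : GraphedDozenClose θ pf)
    (h1 : GraphedDozenClose θ ph) : ChartedChargePricing θ :=
  chartedChargePricing_of_far_cleanApproachHarnack_twelve hθ hR hM₀ hFP hH
    (twelveShellShaped_of_bondGraphs hpf hph hG hA h0 h1)

end Summit.AtomisticToContinuum.Crystallization.Theorems.ChargedEnergyGapChartDial

end
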